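import Summits.AnomalousDissipation.AnomalousDissipation.Theorems.SolenoidalFractalHomogenisationRealisedQuasiStaticCellLawUpperSomeWeights
import HarnessLib

/-!
# K2R `RealisedQuasiStaticCellLaw`, line `floquet-bloch`, stub `stub_upperSome`: the in-plane factor is at most one

Summits-side helper (everything proved; no definitions, no named facts; `--supports stmt-AnomalousDissipation-20446`).
`dot_sq_div_freqNormSq_le_one`: `(ℓ·K)²/(|ℓ|²|K|²) ≤ 1` for integer frequencies (Cauchy–Schwarz; the quotient is `0` when a
norm vanishes). Used by `upperSome_period`. Not anomalous dissipation.
-/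

set_option linter.dupNamespace false -- layout D-0017: `AnomalousDissipation.AnomalousDissipation` repeats by design

noncomputable section

namespace Summit.AnomalousDissipation.AnomalousDissipation.Theorems.SolenoidalFractalHomogenisation.RealisedQuasiStaticCellLaw

open Matrix
open scoped Matrix InnerProductSpace RealInnerProductSpace
open Literature.Analysis Literature.Analysis.FunctionSpaces Literature.Analysis.FunctionSpaces.Torus

/-- **The in-plane factor is at most one**: `(ℓ·K)²/(|ℓ|²|K|²) ≤ 1`. -/
theorem dot_sq_div_freqNormSq_le_one (ℓ K : Fin 3 → ℤ) :
    ((fun i => ((ℓ i : ℤ) : ℝ)) ⬝ᵥ (fun i => ((K i : ℤ) : ℝ))) ^ 2 / (freqNormSq ℓ * freqNormSq K) ≤ 1 := by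
  set lr : Fin 3 → ℝ := fun i => ((ℓ i : ℤ) : ℝ)
  set Kr : Fin 3 → ℝ := fun i => ((K i : ℤ) : ℝ)
  have hℓf : freqNormSq ℓ = lr ⬝ᵥ lr := freqNormSq_eq_dotProduct ℓ
  have hKf : freqNormSq K = Kr ⬝ᵥ Kr := freqNormSq_eq_dotProduct K
  rw [hℓf, hKf]
  by_cases hz : lr ⬝ᵥ lr * (Kr ⬝ᵥ Kr) = 0
  · rw [hz, div_zero]; exact zero_le_one
  · rw [div_le_one (lt_of_le_of_ne (mul_nonneg (by rw [← hℓf]; exact freqNormSq_nonneg _)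
      (by rw [← hKf]; exact freqNormSq_nonneg _)) (Ne.symm hz))]
    have h := abs_real_inner_le_norm (WithLp.toLp 2 lr : EuclideanSpace ℝ (Fin 3)) (WithLp.toLp 2 Kr)
    have e1 : ⟪(WithLp.toLp 2 lr : EuclideanSpace ℝ (Fin 3)), WithLp.toLp 2 Kr⟫ = lr ⬝ᵥ Kr := by
      rw [EuclideanSpace.inner_eq_star_dotProduct, star_trivial, dotProduct_comm]
    have e2 : ‖(WithLp.toLp 2 lr : EuclideanSpace ℝ (Fin 3))‖ ^ 2 = lr ⬝ᵥ lr := by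
      rw [EuclideanSpace.norm_sq_eq, dotProduct]; refine Finset.sum_congr rfl fun i _ => ?_; simp [sq]
    have e3 : ‖(WithLp.toLp 2 Kr : EuclideanSpace ℝ (Fin 3))‖ ^ 2 = Kr ⬝ᵥ Kr := by
      rw [EuclideanSpace.norm_sq_eq, dotProduct]; refine Finset.sum_congr rfl fun i _ => ?_; simp [sq]
    rw [e1] at h
    have h2 : (lr ⬝ᵥ Kr) ^ 2 ≤ (‖(WithLp.toLp 2 lr : EuclideanSpace ℝ (Fin 3))‖ * ‖(WithLp.toLp 2 Kr : EuclideanSpace ℝ (Fin 3))‖) ^ 2 := by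
      rw [← sq_abs]; exact pow_le_pow_left₀ (abs_nonneg _) h 2
    rw [mul_pow, e2, e3] at h2
    exact h2

end Summit.AnomalousDissipation.AnomalousDissipation.Theorems.SolenoidalFractalHomogenisation.RealisedQuasiStaticCellLaw

end
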